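import Summits.QuantumFields.QCD.Theses.GapBuysCauchyRate
import Summits.QuantumFields.QCD.Theorems.QuarksAsStableActionStableActionBridgeDefs
import Literature.MathematicalPhysics.QuantumFieldTheory.MassGapFromLatticeClustering
import Literature.MathematicalPhysics.QuantumFieldTheory.QCDAsymptoticScalingCouplingDivergence
import Summits.QuantumFields.QCD.Theorems.GapBuysCauchyRateConvergentOSClosureStubSoftClosure
import Summits.QuantumFields.QCD.Theorems.GapBuysCauchyRateConvergentOSClosureStubAsymptoticTranslation
import Summits.QuantumFields.QCD.Theorems.GapBuysCauchyRateConvergentOSClosureStubSpeciesPackaging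
import Summits.QuantumFields.QCD.Theorems.GapBuysCauchyRateConvergentOSClosureStubRpOfComparison
import HarnessLib

/-!
# Stub `stub_closureOfLatticeInputs` of line `registered` — and the repaired crux R′
(crux `Summit.QuantumFields.QCD.Theses.GapBuysCauchyRate.ConvergentOSClosure`, item stmt-QuantumFields-11525,
route route-QuantumFields-GapBuysCauchyRate; helper file, `--supports stmt-QuantumFields-11525`)

## Summary

The crux `ConvergentOSClosure` asks: a calibrated lattice-QCD family `𝒞.scheme m` that scales asymptotically, sits
eventually on the physical branch, has a uniform lattice gap, obeys the calibration and `κ₃` clauses and whose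
calibrated `n`-point functions converge on off-diagonal real tensors has a labelled Schwinger limit `S` with E0
(normalisation, hermiticity), E0′ (linear growth), translations on `⁰𝒮`, E2, E3, E4, the limit clause, a species mass
gap at the lattice `Δ`, and — once `S` is invariant under proper rotations — OS data with the non-triviality
witnesses.  Every proof of that conclusion consumes four LATTICE-SIDE INPUTS which the crux hypotheses do not carry
(five lead seats of the crux protocol, 2026-08-17, `Cruxes/ConvergentOSClosure/LEAD*-ASSESSMENT.md`):

* (T) a k-uniform E0′ bound on `⁰𝒮` for the canonical lattice distributions `qcdLatticeDist sch k`
  (the analogue of the uniform bound (17.9.1) of Glimm–Jaffe, *Quantum Physics*, Thm 17.9.1);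
* (COMP) the E0′-norm comparison of the time-periodic own-torus distributions with the Θ-symmetrised thermal ones
  `qcdLatticeDistSymAP` (the finite-volume input behind reflection positivity of the limit);
* (CL) k-uniform spatial clustering of `qcdLatticeDist sch k` (the E4 input);
* (CS) species Cauchy–Schwarz clustering `sch.HasSpeciesCSClustering Δ'` at some `Δ' > 0` (the gap input in OS currency).

This file proves, scheme-generically, that these inputs SUFFICE (`stub_closureOfLatticeInputs`, the closed stub of
the reshaped skeleton `Cruxes/ConvergentOSClosure/Lines/registered.lean` through which its `N_f ≤ 16` branch runs):
for ANY scheme `sch : QCDScheme Nf` with `N_f ≤ 16` that scales asymptotically (two-loop AF ⇒ couplings eventually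
`≥ 0`, `QCDScheme.eventually_le_beta_of_hasAsymptoticScaling`) and sits eventually on the physical branch, convergence
on off-diagonal real tensors + T + COMP + CL + the lattice gap at `Δ` + CS at `Δ'` give the labelled limit with E0,
E0′, translations on `⁰𝒮`, E2, E3, E4, the limit clause and both gaps at one positive rate — by composing three landed
helper files of the item: asymptotic translation invariance P6 from T (`tendsto_qcdLatticeDist_translateMulti_sub`,
file `…StubAsymptoticTranslation`), eventually approximately positive OS forms P8 from T + COMP
(`stub_rpOfComparison`), and the soft OS closure (`stub_softClosure`).

Corollary (`convergentOSClosure_retyped`): the REPAIRED CRUX R′ of the crux directory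
(`Cruxes/ConvergentOSClosure/RetypeRoute.lean`, `ConvergentOSClosureRetyped`, conclusion verbatim) — the typed crux
with `N_f ≤ 16` and the per-`(reg, 𝒞, m)` clauses (T ∧ COMP), CL, CS added as hypotheses — is a theorem (the
packaging clause is the landed `stub_speciesPackaging`).  `convergentOSClosureRetyped_of_convergentOSClosure` records
that the crux as typed implies R′ (the re-type only adds hypotheses).

References: Osterwalder–Schrader II, CMP 42 (1975) §2, §4; Glimm–Jaffe, *Quantum Physics* (1987) §6.1, §17.9;
Osterwalder–Seiler, Ann. Phys. 110 (1978) §§2–4.  No definitions, no named facts, no `sorry`.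
-/

noncomputable section

open scoped BigOperators Topology
open MeasureTheory Filter
open Literature.MathematicalPhysics.AQFT Literature.MathematicalPhysics.QuantumLattice
  Literature.MathematicalPhysics.QuantumFieldTheory
open Summit.QuantumFields.QCD.Cruxes.StableActionBridge.Sketch (qcdLatticeDist qcdLatticeDistSymAP)

namespace Summit.QuantumFields.QCD.Theorems.ConvergentOSClosure

/-- **Closure of the lattice-side inputs (scheme-generic).**  For `N_f ≤ 16` and any scheme `sch` that scales
asymptotically and sits eventually on the physical branch: convergence of the honest lattice `n`-point functions on
off-diagonal real tensors, a k-uniform E0′ bound (T) with constants `s, α, β`, the E0′-norm comparison periodic ↔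
Θ-symmetrised thermal distributions at the same norm index (COMP), k-uniform spatial clustering (CL), the lattice gap at
`Δ > 0` and species Cauchy–Schwarz clustering at `Δ' > 0` (CS) give a labelled Schwinger limit `S` with E0
(normalisation, hermiticity), E0′, translation invariance on `⁰𝒮`, E2, E3, E4, the convergence-to-`S` clause on
off-diagonal real tensors, and a species mass gap of `S` together with the lattice gap at one common `Δ₀ > 0`. -/
theorem stub_closureOfLatticeInputs :
    ∀ (Nf : ℕ) (sch : QCDScheme Nf), Nf ≤ 16 → sch.HasAsymptoticScaling →
    (∀ fl : Fin Nf, ∀ᶠ k in Filter.atTop, -1 < sch.mq fl k) →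
    (∀ n : ℕ, n ≠ 0 → ∀ (σ : Fin n → QCDField Nf) (f : Fin n → SchwartzMap (EuclideanSpace ℝ (Fin 4)) ℝ)
      (F : SchwartzMap (Fin n → EuclideanSpace ℝ (Fin 4)) ℂ), IsTensorOf F (fun i => ofRealTest (f i)) →
      IsOffDiagonal F → ∃ c : ℂ, Filter.Tendsto (fun k : ℕ => qcdLatticeSchwinger sch k n σ f) Filter.atTop (nhds c)) →
    ∀ (s : ℕ) (α β : ℝ), 0 ≤ α →
    (∀ (n : ℕ) (σ : Fin n → QCDField Nf), ∀ᶠ k in Filter.atTop,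
      ∀ F : SchwartzMap (Fin n → EuclideanSpace ℝ (Fin 4)) ℂ, IsOffDiagonal F →
        ‖qcdLatticeDist sch k n σ F‖ ≤ α * (n.factorial : ℝ) ^ β * schwartzNorm (n * s) F) →
    (∀ ε : ℝ, 0 < ε → ∀ (n : ℕ) (σ : Fin n → QCDField Nf), ∀ᶠ k in Filter.atTop,
      ∀ F : SchwartzMap (Fin n → EuclideanSpace ℝ (Fin 4)) ℂ, IsOffDiagonal F →
        ‖qcdLatticeDistSymAP sch k n σ F - qcdLatticeDist sch k n σ F‖ ≤ ε * schwartzNorm (n * s) F) →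
    (∀ (n n' : ℕ) (σ : Fin n → QCDField Nf) (σ' : Fin n' → QCDField Nf)
      (F : SchwartzMap (Fin n → EuclideanSpace ℝ (Fin 4)) ℂ) (G : SchwartzMap (Fin n' → EuclideanSpace ℝ (Fin 4)) ℂ),
      IsTimeOrdered F → IsTimeOrdered G → ∀ a : EuclideanSpace ℝ (Fin 4), a 0 = 0 → a ≠ 0 →
      ∀ ε : ℝ, 0 < ε → ∃ t₀ : ℝ, ∀ t : ℝ, t₀ ≤ t →
        ∀ H : SchwartzMap (Fin (n + n') → EuclideanSpace ℝ (Fin 4)) ℂ,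
          IsAppendTensorOf H (osAdjoint F) (translateMulti (t • a) G) →
          ∀ᶠ k in Filter.atTop, ‖qcdLatticeDist sch k (n + n') (Fin.append (σ ∘ Fin.rev) σ') H -
            qcdLatticeDist sch k n (σ ∘ Fin.rev) (osAdjoint F) * qcdLatticeDist sch k n' σ' G‖ ≤ ε) →
    ∀ (Δ Δ' : ℝ), 0 < Δ → 0 < Δ' → sch.HasLatticeMassGap Δ → sch.HasSpeciesCSClustering Δ' →
    ∃ S : LabelledSchwingerFamily (QCDField Nf) (EuclideanSpace ℝ (Fin 4)), S.IsNormalized ∧ S.IsHermitian ∧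
      S.HasLinearGrowth ∧
      (∀ (n : ℕ) (σ : Fin n → QCDField Nf) (a : EuclideanSpace ℝ (Fin 4))
        (F : SchwartzMap (Fin n → EuclideanSpace ℝ (Fin 4)) ℂ), IsOffDiagonal F →
          S n σ (translateMulti a F) = S n σ F) ∧
      S.IsReflectionPositive ∧ S.IsSymmetric ∧ S.HasClusterProperty ∧
      (∀ n : ℕ, n ≠ 0 → ∀ (σ : Fin n → QCDField Nf) (f : Fin n → SchwartzMap (EuclideanSpace ℝ (Fin 4)) ℝ)
        (F : SchwartzMap (Fin n → EuclideanSpace ℝ (Fin 4)) ℂ), IsTensorOf F (fun i => ofRealTest (f i)) →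
        IsOffDiagonal F → Filter.Tendsto (fun k : ℕ => qcdLatticeSchwinger sch k n σ f) Filter.atTop (nhds (S n σ F))) ∧
      (∃ Δ₀ : ℝ, 0 < Δ₀ ∧ S.HasMassGap Δ₀ ∧ sch.HasLatticeMassGap Δ₀) := by
  intro Nf sch hNf hAS hbr hconv s α β hα hb hcomp hcl Δ Δ' hΔ hΔ' hgapΔ hCS
  -- P6 (asymptotic translation invariance on `⁰𝒮`) from the E0′ bound T, per `(n, σ)`
  have htr : ∀ (n : ℕ) (σ : Fin n → QCDField Nf) (a : EuclideanSpace ℝ (Fin 4))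
      (F : SchwartzMap (Fin n → EuclideanSpace ℝ (Fin 4)) ℂ), IsOffDiagonal F →
        Filter.Tendsto (fun k : ℕ => qcdLatticeDist sch k n σ (translateMulti a F) - qcdLatticeDist sch k n σ F)
          Filter.atTop (nhds 0) := fun n σ a F hF =>
    tendsto_qcdLatticeDist_translateMulti_sub sch σ
      (mul_nonneg hα (Real.rpow_nonneg (Nat.cast_nonneg _) β)) (n * s) (hb n σ) a F hF
  -- P8 (eventually approximately positive OS forms) from T + COMP and eventually non-negative couplings
  have hrp := stub_rpOfComparison Nf sch (QCDScheme.eventually_le_beta_of_hasAsymptoticScaling hNf sch hAS 0)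
    hbr s α β hα hb hcomp
  -- the soft OS closure
  exact stub_softClosure Nf sch hconv s α β hα hb htr hrp hcl Δ Δ' hΔ hΔ' hgapΔ hCS

/-- **R′ — the repaired crux**: `ConvergentOSClosure` with `N_f ≤ 16` and, per `(reg, 𝒞, m)`, the lattice-side inputs
(T ∧ COMP) (one norm index `s`), CL, CS added as hypotheses; conclusion VERBATIM (so that a re-type of the item to this
text closes by `exact convergentOSClosure_retyped`).  Proof: `stub_closureOfLatticeInputs` for the axioms, the limit
clause and the gaps, and the landed `stub_speciesPackaging` for the OS packaging with the non-triviality witnesses. -/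
theorem convergentOSClosure_retyped :
    ∀ (Nf : ℕ) (reg : QCDRegularisation Nf) (𝒞 : CalibratedSpeciesFamily reg) (m : Fin Nf → ℝ), Nf ≤ 16 →
    (∀ f, 0 < m f) → (𝒞.scheme m).HasAsymptoticScaling →
    (∀ fl : Fin Nf, ∀ᶠ k in Filter.atTop, -1 < (𝒞.scheme m).mq fl k) →
    (∃ Δ > 0, (𝒞.scheme m).HasLatticeMassGap Δ) →
    (∀ᶠ k in Filter.atTop,
      (𝒞.scheme m).twoPoint k QCDField.glue QCDField.glue (thetaTest 4 𝒞.f₀) 𝒞.f₀ = 1) →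
    (∀ f g : Fin Nf, f ≠ g → ∀ᶠ k in Filter.atTop,
      (𝒞.scheme m).twoPoint k (QCDField.pseudoRe f g) (QCDField.pseudoRe f g) (thetaTest 4 𝒞.f₀) 𝒞.f₀ = 1) →
    (∃ f g h : SchwartzMap (EuclideanSpace ℝ (Fin 4)) ℝ,
      tsupport (f : EuclideanSpace ℝ (Fin 4) → ℝ) ⊆ {x | x 0 < 0} ∧
      tsupport (g : EuclideanSpace ℝ (Fin 4) → ℝ) ⊆ {x | 0 < x 0 ∧ x 0 < 1} ∧
      tsupport (h : EuclideanSpace ℝ (Fin 4) → ℝ) ⊆ {x | 1 < x 0} ∧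
      ∃ ε > (0 : ℝ), ∀ᶠ k in Filter.atTop, ε ≤ ‖qcdLatticeSchwinger (𝒞.scheme m) k 3
        ![QCDField.glue, QCDField.glue, QCDField.glue] ![f, g, h] -
        qcdLatticeSchwinger (𝒞.scheme m) k 1 ![QCDField.glue] ![f] *
          qcdLatticeSchwinger (𝒞.scheme m) k 2 ![QCDField.glue, QCDField.glue] ![g, h] -
        qcdLatticeSchwinger (𝒞.scheme m) k 1 ![QCDField.glue] ![g] *
          qcdLatticeSchwinger (𝒞.scheme m) k 2 ![QCDField.glue, QCDField.glue] ![f, h] -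
        qcdLatticeSchwinger (𝒞.scheme m) k 1 ![QCDField.glue] ![h] *
          qcdLatticeSchwinger (𝒞.scheme m) k 2 ![QCDField.glue, QCDField.glue] ![f, g] +
        2 * (qcdLatticeSchwinger (𝒞.scheme m) k 1 ![QCDField.glue] ![f] *
          qcdLatticeSchwinger (𝒞.scheme m) k 1 ![QCDField.glue] ![g] *
          qcdLatticeSchwinger (𝒞.scheme m) k 1 ![QCDField.glue] ![h])‖) →
    (∀ n : ℕ, n ≠ 0 → ∀ (σ : Fin n → QCDField Nf) (f : Fin n → SchwartzMap (EuclideanSpace ℝ (Fin 4)) ℝ)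
      (F : SchwartzMap (Fin n → EuclideanSpace ℝ (Fin 4)) ℂ), IsTensorOf F (fun i => ofRealTest (f i)) →
      IsOffDiagonal F →
        ∃ c : ℂ, Filter.Tendsto (fun k : ℕ => qcdLatticeSchwinger (𝒞.scheme m) k n σ f) Filter.atTop (nhds c)) →
    -- (T ∧ COMP): k-uniform E0′ bound and the periodic ↔ Θ-symmetrised thermal comparison, same norm index `s`
    (∃ (s : ℕ) (α β : ℝ), 0 ≤ α ∧
      (∀ (n : ℕ) (σ : Fin n → QCDField Nf), ∀ᶠ k in Filter.atTop,
        ∀ F : SchwartzMap (Fin n → EuclideanSpace ℝ (Fin 4)) ℂ, IsOffDiagonal F →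
          ‖qcdLatticeDist (𝒞.scheme m) k n σ F‖ ≤ α * (n.factorial : ℝ) ^ β * schwartzNorm (n * s) F) ∧
      (∀ ε : ℝ, 0 < ε → ∀ (n : ℕ) (σ : Fin n → QCDField Nf), ∀ᶠ k in Filter.atTop,
        ∀ F : SchwartzMap (Fin n → EuclideanSpace ℝ (Fin 4)) ℂ, IsOffDiagonal F →
          ‖qcdLatticeDistSymAP (𝒞.scheme m) k n σ F - qcdLatticeDist (𝒞.scheme m) k n σ F‖ ≤
            ε * schwartzNorm (n * s) F)) →
    -- (CL): k-uniform spatial clustering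
    (∀ (n n' : ℕ) (σ : Fin n → QCDField Nf) (σ' : Fin n' → QCDField Nf)
      (F : SchwartzMap (Fin n → EuclideanSpace ℝ (Fin 4)) ℂ) (G : SchwartzMap (Fin n' → EuclideanSpace ℝ (Fin 4)) ℂ),
      IsTimeOrdered F → IsTimeOrdered G → ∀ a : EuclideanSpace ℝ (Fin 4), a 0 = 0 → a ≠ 0 →
      ∀ ε : ℝ, 0 < ε → ∃ t₀ : ℝ, ∀ t : ℝ, t₀ ≤ t →
        ∀ H : SchwartzMap (Fin (n + n') → EuclideanSpace ℝ (Fin 4)) ℂ,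
          IsAppendTensorOf H (osAdjoint F) (translateMulti (t • a) G) →
          ∀ᶠ k in Filter.atTop, ‖qcdLatticeDist (𝒞.scheme m) k (n + n') (Fin.append (σ ∘ Fin.rev) σ') H -
            qcdLatticeDist (𝒞.scheme m) k n (σ ∘ Fin.rev) (osAdjoint F) *
              qcdLatticeDist (𝒞.scheme m) k n' σ' G‖ ≤ ε) →
    -- (CS): species Cauchy–Schwarz clustering at some positive rate
    (∃ Δ' > 0, (𝒞.scheme m).HasSpeciesCSClustering Δ') →
    ∃ S : LabelledSchwingerFamily (QCDField Nf) (EuclideanSpace ℝ (Fin 4)), S.IsNormalized ∧ S.IsHermitian ∧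
      S.HasLinearGrowth ∧
      (∀ (n : ℕ) (σ : Fin n → QCDField Nf) (a : EuclideanSpace ℝ (Fin 4))
        (F : SchwartzMap (Fin n → EuclideanSpace ℝ (Fin 4)) ℂ), IsOffDiagonal F →
          S n σ (translateMulti a F) = S n σ F) ∧
      S.IsReflectionPositive ∧ S.IsSymmetric ∧ S.HasClusterProperty ∧
      (∀ n : ℕ, n ≠ 0 → ∀ (σ : Fin n → QCDField Nf) (f : Fin n → SchwartzMap (EuclideanSpace ℝ (Fin 4)) ℝ)
        (F : SchwartzMap (Fin n → EuclideanSpace ℝ (Fin 4)) ℂ), IsTensorOf F (fun i => ofRealTest (f i)) →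
        IsOffDiagonal F →
          Filter.Tendsto (fun k : ℕ => qcdLatticeSchwinger (𝒞.scheme m) k n σ f) Filter.atTop (nhds (S n σ F))) ∧
      (∃ Δ : ℝ, 0 < Δ ∧ S.HasMassGap Δ ∧ (𝒞.scheme m).HasLatticeMassGap Δ) ∧
      ((∀ (n : ℕ) (σ : Fin n → QCDField Nf) (Rot : EuclideanSpace ℝ (Fin 4) ≃ₗᵢ[ℝ] EuclideanSpace ℝ (Fin 4)),
          LinearMap.det (Rot.toLinearEquiv : EuclideanSpace ℝ (Fin 4) →ₗ[ℝ] EuclideanSpace ℝ (Fin 4)) = 1 →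
          ∀ F : SchwartzMap (Fin n → EuclideanSpace ℝ (Fin 4)) ℂ, IsOffDiagonal F →
            S n σ (linActMulti Rot F) = S n σ F) →
        ∃ T : OSData (QCDField Nf) 4, T.schwinger = S ∧ T.IsNontrivial QCDField.glue ∧
          T.IsNonGaussian QCDField.glue ∧ ∀ f g : Fin Nf, f ≠ g → T.IsNontrivial (QCDField.pseudoRe f g)) := by
  intro Nf reg 𝒞 m hNf _hm hAS hbr hgap h2g h2q h3g hconv hTC hcl hCS
  obtain ⟨s, α, β, hα, hb, hcomp⟩ := hTC
  obtain ⟨Δ, hΔ, hgapΔ⟩ := hgap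
  obtain ⟨Δ', hΔ', hCS'⟩ := hCS
  obtain ⟨S, h0, h0', hE0', hE1t, hE2, hE3, hE4, htensor, hgap₀⟩ :=
    stub_closureOfLatticeInputs Nf (𝒞.scheme m) hNf hAS hbr hconv s α β hα hb hcomp hcl Δ Δ' hΔ hΔ' hgapΔ hCS'
  exact ⟨S, h0, h0', hE0', hE1t, hE2, hE3, hE4, htensor, hgap₀, fun hRot =>
    stub_speciesPackaging Nf reg 𝒞 m h2g h2q h3g S ⟨⟨h0, h0', ⟨hE1t, hRot⟩, hE2, hE3, hE4⟩, hE0'⟩ htensor⟩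

/-- **The crux as typed implies R′**: re-typing `ConvergentOSClosure` to the hypotheses of
`convergentOSClosure_retyped` only ADDS hypotheses (`N_f ≤ 16`, (T ∧ COMP), CL, CS) and keeps the conclusion, so it
loses nothing — every consumer of the crux (the route's deciding theorem uses only the limit clause, the gap conjunct and
the packaging implication) is served by R′ once the producer `LadderCauchyRate` delivers the three clauses. -/
theorem convergentOSClosureRetyped_of_convergentOSClosure
    (h : Summit.QuantumFields.QCD.Theses.GapBuysCauchyRate.ConvergentOSClosure) :
    ∀ (Nf : ℕ) (reg : QCDRegularisation Nf) (𝒞 : CalibratedSpeciesFamily reg) (m : Fin Nf → ℝ), Nf ≤ 16 →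
    (∀ f, 0 < m f) → (𝒞.scheme m).HasAsymptoticScaling →
    (∀ fl : Fin Nf, ∀ᶠ k in Filter.atTop, -1 < (𝒞.scheme m).mq fl k) →
    (∃ Δ > 0, (𝒞.scheme m).HasLatticeMassGap Δ) →
    (∀ᶠ k in Filter.atTop,
      (𝒞.scheme m).twoPoint k QCDField.glue QCDField.glue (thetaTest 4 𝒞.f₀) 𝒞.f₀ = 1) →
    (∀ f g : Fin Nf, f ≠ g → ∀ᶠ k in Filter.atTop,
      (𝒞.scheme m).twoPoint k (QCDField.pseudoRe f g) (QCDField.pseudoRe f g) (thetaTest 4 𝒞.f₀) 𝒞.f₀ = 1) →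
    (∃ f g h : SchwartzMap (EuclideanSpace ℝ (Fin 4)) ℝ,
      tsupport (f : EuclideanSpace ℝ (Fin 4) → ℝ) ⊆ {x | x 0 < 0} ∧
      tsupport (g : EuclideanSpace ℝ (Fin 4) → ℝ) ⊆ {x | 0 < x 0 ∧ x 0 < 1} ∧
      tsupport (h : EuclideanSpace ℝ (Fin 4) → ℝ) ⊆ {x | 1 < x 0} ∧
      ∃ ε > (0 : ℝ), ∀ᶠ k in Filter.atTop, ε ≤ ‖qcdLatticeSchwinger (𝒞.scheme m) k 3
        ![QCDField.glue, QCDField.glue, QCDField.glue] ![f, g, h] -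
        qcdLatticeSchwinger (𝒞.scheme m) k 1 ![QCDField.glue] ![f] *
          qcdLatticeSchwinger (𝒞.scheme m) k 2 ![QCDField.glue, QCDField.glue] ![g, h] -
        qcdLatticeSchwinger (𝒞.scheme m) k 1 ![QCDField.glue] ![g] *
          qcdLatticeSchwinger (𝒞.scheme m) k 2 ![QCDField.glue, QCDField.glue] ![f, h] -
        qcdLatticeSchwinger (𝒞.scheme m) k 1 ![QCDField.glue] ![h] *
          qcdLatticeSchwinger (𝒞.scheme m) k 2 ![QCDField.glue, QCDField.glue] ![f, g] +
        2 * (qcdLatticeSchwinger (𝒞.scheme m) k 1 ![QCDField.glue] ![f] *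
          qcdLatticeSchwinger (𝒞.scheme m) k 1 ![QCDField.glue] ![g] *
          qcdLatticeSchwinger (𝒞.scheme m) k 1 ![QCDField.glue] ![h])‖) →
    (∀ n : ℕ, n ≠ 0 → ∀ (σ : Fin n → QCDField Nf) (f : Fin n → SchwartzMap (EuclideanSpace ℝ (Fin 4)) ℝ)
      (F : SchwartzMap (Fin n → EuclideanSpace ℝ (Fin 4)) ℂ), IsTensorOf F (fun i => ofRealTest (f i)) →
      IsOffDiagonal F →
        ∃ c : ℂ, Filter.Tendsto (fun k : ℕ => qcdLatticeSchwinger (𝒞.scheme m) k n σ f) Filter.atTop (nhds c)) →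
    (∃ (s : ℕ) (α β : ℝ), 0 ≤ α ∧
      (∀ (n : ℕ) (σ : Fin n → QCDField Nf), ∀ᶠ k in Filter.atTop,
        ∀ F : SchwartzMap (Fin n → EuclideanSpace ℝ (Fin 4)) ℂ, IsOffDiagonal F →
          ‖qcdLatticeDist (𝒞.scheme m) k n σ F‖ ≤ α * (n.factorial : ℝ) ^ β * schwartzNorm (n * s) F) ∧
      (∀ ε : ℝ, 0 < ε → ∀ (n : ℕ) (σ : Fin n → QCDField Nf), ∀ᶠ k in Filter.atTop,
        ∀ F : SchwartzMap (Fin n → EuclideanSpace ℝ (Fin 4)) ℂ, IsOffDiagonal F →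
          ‖qcdLatticeDistSymAP (𝒞.scheme m) k n σ F - qcdLatticeDist (𝒞.scheme m) k n σ F‖ ≤
            ε * schwartzNorm (n * s) F)) →
    (∀ (n n' : ℕ) (σ : Fin n → QCDField Nf) (σ' : Fin n' → QCDField Nf)
      (F : SchwartzMap (Fin n → EuclideanSpace ℝ (Fin 4)) ℂ) (G : SchwartzMap (Fin n' → EuclideanSpace ℝ (Fin 4)) ℂ),
      IsTimeOrdered F → IsTimeOrdered G → ∀ a : EuclideanSpace ℝ (Fin 4), a 0 = 0 → a ≠ 0 →
      ∀ ε : ℝ, 0 < ε → ∃ t₀ : ℝ, ∀ t : ℝ, t₀ ≤ t →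
        ∀ H : SchwartzMap (Fin (n + n') → EuclideanSpace ℝ (Fin 4)) ℂ,
          IsAppendTensorOf H (osAdjoint F) (translateMulti (t • a) G) →
          ∀ᶠ k in Filter.atTop, ‖qcdLatticeDist (𝒞.scheme m) k (n + n') (Fin.append (σ ∘ Fin.rev) σ') H -
            qcdLatticeDist (𝒞.scheme m) k n (σ ∘ Fin.rev) (osAdjoint F) *
              qcdLatticeDist (𝒞.scheme m) k n' σ' G‖ ≤ ε) →
    (∃ Δ' > 0, (𝒞.scheme m).HasSpeciesCSClustering Δ') →
    ∃ S : LabelledSchwingerFamily (QCDField Nf) (EuclideanSpace ℝ (Fin 4)), S.IsNormalized ∧ S.IsHermitian ∧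
      S.HasLinearGrowth ∧
      (∀ (n : ℕ) (σ : Fin n → QCDField Nf) (a : EuclideanSpace ℝ (Fin 4))
        (F : SchwartzMap (Fin n → EuclideanSpace ℝ (Fin 4)) ℂ), IsOffDiagonal F →
          S n σ (translateMulti a F) = S n σ F) ∧
      S.IsReflectionPositive ∧ S.IsSymmetric ∧ S.HasClusterProperty ∧
      (∀ n : ℕ, n ≠ 0 → ∀ (σ : Fin n → QCDField Nf) (f : Fin n → SchwartzMap (EuclideanSpace ℝ (Fin 4)) ℝ)
        (F : SchwartzMap (Fin n → EuclideanSpace ℝ (Fin 4)) ℂ), IsTensorOf F (fun i => ofRealTest (f i)) →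
        IsOffDiagonal F →
          Filter.Tendsto (fun k : ℕ => qcdLatticeSchwinger (𝒞.scheme m) k n σ f) Filter.atTop (nhds (S n σ F))) ∧
      (∃ Δ : ℝ, 0 < Δ ∧ S.HasMassGap Δ ∧ (𝒞.scheme m).HasLatticeMassGap Δ) ∧
      ((∀ (n : ℕ) (σ : Fin n → QCDField Nf) (Rot : EuclideanSpace ℝ (Fin 4) ≃ₗᵢ[ℝ] EuclideanSpace ℝ (Fin 4)),
          LinearMap.det (Rot.toLinearEquiv : EuclideanSpace ℝ (Fin 4) →ₗ[ℝ] EuclideanSpace ℝ (Fin 4)) = 1 →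
          ∀ F : SchwartzMap (Fin n → EuclideanSpace ℝ (Fin 4)) ℂ, IsOffDiagonal F →
            S n σ (linActMulti Rot F) = S n σ F) →
        ∃ T : OSData (QCDField Nf) 4, T.schwinger = S ∧ T.IsNontrivial QCDField.glue ∧
          T.IsNonGaussian QCDField.glue ∧ ∀ f g : Fin Nf, f ≠ g → T.IsNontrivial (QCDField.pseudoRe f g)) :=
  fun Nf reg 𝒞 m _ hm hAS hbr hgap h2g h2q h3g hconv _ _ _ => h Nf reg 𝒞 m hm hAS hbr hgap h2g h2q h3g hconv

end Summit.QuantumFields.QCD.Theorems.ConvergentOSClosure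

end
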